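import Summits.QuantumFields.BalabanUV.Beta.CovariantTowerLocality

/-!
# Beta / CovariantTowerCover — THE COUNTING NUMBER OF THE BLOCK-HULL COVER, EXPLICIT: every point of the torus lies in at
# most (2(M₀ + 1 + 2S_k)/M₀ + 3)^d of the regions Ω₀(z); hence THM 3.7-SHAPE IN ℓ² for the k-fold covariant tower operator
# of the pv21 MODEL with NO hypothesis beyond the data except the explicit largeness of the partition scale M₀
# (unit `b2b-balaban-beta-d4-p2`, GEN 4; node (m1) of `beta/skeletons/D4-NODE-O2-b2b-balaban-beta-d4-p2.md`, geometric
# half, part 2 — the last; imports `CovariantTowerLocality` only)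

HONEST FRAMING: discharging `BetaPertH` makes Bałaban's UV stability UNCONDITIONAL — NOT the continuum limit, NOT the
Clay problem.  HONEST DEPENDENCY (verbatim): «continuum YM on T⁴ ⇐ BetaPertH ∧ nine spine estimates (0/9 proved);
BetaPertH ⇐ (D1) ∧ (D4) ∧ CAP+tail; G-an2-4 gates asym, D1 and NE2/3/4.»  THIS MODULE DISCHARGES NOTHING of `BetaPertH`,
asserts NOTHING printed and cites nothing as a fact (ABSOLUTE RULE): [folklore] kernel theorems about the component MODEL of
the pv21 chain ([B9] = `Balaban1985BackgroundPropagators`, Commun. Math. Phys. 99 (1985) 389–434; SHAPES: (3.87)–(3.90)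
p. 409, Thm 3.7 «for M sufficiently large»; [B5] p. 36 «these cubes cover the lattice» — the sparse count is b05's
`B5TorusCover.hnu_holds`).

CONTENT.
* §1 `dist_le_of_towerBlk_eq` (two points of one level-k tower block are within 2S_k, S_k = `towerS (j ↦ d(M_j − 1)) k`, in
  the torus distance — `CovariantTowerDecay.abs_sub_le_of_towerBlk_eq` applied to the 1-Lipschitz weight dist(x, ·)),
  `dist_lt_of_omegaBall_eq_one` (Ω₀(z)(x) = 1 ⇒ dist(x, centre z) < M₀ + 1 + 2S_k),
  **`sum_omegaBall_le`**: Σ_z Ω₀(z)(x) ≤ ν_k(M₀) := (2(M₀ + 1 + 2S_k)/M₀ + 3)^d (`coverNumber`) for every x, every torus —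
  b05's sparse count `hnu_holds` of the centres within c̄M₀ of a point.
* §2 **`parametrix_l2_tower_torus_explicit`**: for the k-fold tower operator Δ′ on every torus `UT N` (cube-comb tower of
  sides M_j ∣ N_i, uniform block weights, top level on, every isometric transport), the b05 partition of unity at scale M₀
  and q := ν_k(M₀)·C_rem/M₀ < 1:  Δ′⁻¹ = G′₀∘(1 − R′)⁻¹ and ‖Δ′⁻¹‖_{ℓ²} ≤ ν_k(M₀)·σ_k⁻¹·(1 − q)⁻¹ — NO hypothesis beyond the
  data and the one explicit inequality q < 1 («M sufficiently large»: C_rem, ν_k(M₀) ≤ (7 + 4S_k)^d for M₀ ≥ 1 + 2S_k are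
  explicit in (d, M, k, a, c, w)).

NOT ASSERTED: anything printed; ℓ² currency, bond-step metric, crude and k-DEPENDENT constants (σ_k — item (v) of the O.2
skeleton); only the resolvent form of the expansion (no box-walk indexing of Σ_nG′₀R′ⁿ); the vector-field operators, Ū and
print's multiscale norms are untouched.  Row D4: RECORDS value (O.2 skeleton node (m1) COMPLETE in the MODEL); class of
(T3)/NODE O.2 unchanged; D4 DISCHARGE NO DATE; NOT BetaPertH, NOT continuum, NOT Clay.
-/

namespace Summit.QuantumFields.BalabanUV.Beta.CovariantTowerCover

open Finset
open Literature.MathematicalPhysics.QuantumFieldTheory.Balaban1983to89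
open B9Thm37Sum B9Thm37Glue B9Thm37GluePU B9Thm37GlueTorusInv B9Thm37GlueTorusCov B9Thm37GlueTorusCovComp
open B9Thm37GlueTorusCovPoinc (tdepth_le card_block_le)
open B9Thm37GlueTorusCovLevels B9Thm37GlueTorusCovLevelsPoinc B9Thm37GlueTorusCovTower B9Thm37GlueTorusCovTowerDir
open B9Thm37GlueTorusCovTowerPU (towerK omegaBall omegaBall_zero_or_one omegaBall_eq_one blkHull)
open B9Thm37GlueTorusCovCT (abs_sub_dist_le)
open Summit.QuantumFields.BalabanUV.Beta.CovariantTowerDecay (towerS abs_sub_le_of_towerBlk_eq)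
open Summit.QuantumFields.BalabanUV.Beta.CovariantTowerL2
open Summit.QuantumFields.BalabanUV.Beta.CovariantTowerRemainder
open Summit.QuantumFields.BalabanUV.Beta.CovariantTowerParametrix
open Summit.QuantumFields.BalabanUV.Beta.CovariantTowerLocality
open B5TorusCover (UT Ctr ctrU hnu_holds)
open B5SmoothPartition (hSU)

noncomputable section

section Torus

variable {d : ℕ} {N : Fin d → ℕ} [∀ i, NeZero (N i)] [NeZero d]

/-! ## §1  The block-hull cover has an explicit multiplicity -/

/-- **Two points of one level-k tower block are within 2S_k** (S_k = `towerS (j ↦ d(M_j − 1)) k`; the weight dist(x, ·) is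
1-Lipschitz across nearest-neighbour bonds). [folklore] -/
theorem dist_le_of_towerBlk_eq {M : ℕ → ℕ} (hM : ∀ j, 1 ≤ M j) (hdiv : ∀ j i, M j ∣ N i) (k : ℕ) {x x' : UT N}
    (h : towerBlk (torusTower hM hdiv) k x = towerBlk (torusTower hM hdiv) k x') :
    dist x x' ≤ 2 * (towerS (fun j => d * (M j - 1)) k : ℝ) := by
  have hb := abs_sub_le_of_towerBlk_eq (torusTower hM hdiv) (fun y => (1 : ℝ) * dist x y) zero_le_one
    (fun b => abs_sub_dist_le x zero_le_one b) (D := fun j => d * (M j - 1)) (fun j y => tdepth_le (hM j) y) h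
  simp only [dist_self, mul_zero, zero_sub, abs_neg, one_mul, mul_one] at hb
  rwa [abs_of_nonneg dist_nonneg] at hb

/-- **Ω₀(z)(x) = 1 ⇒ dist(x, centre of z) < M₀ + 1 + 2S_k** (the block of x meets the (M₀ + 1)-ball). [folklore] -/
theorem dist_lt_of_omegaBall_eq_one {M : ℕ → ℕ} (hM : ∀ j, 1 ≤ M j) (hdiv : ∀ j i, M j ∣ N i) (k M₀ : ℕ)
    (z : Ctr N M₀) (x : UT N) (hx : omegaBall hM hdiv k M₀ z x = 1) :
    dist x (ctrU N M₀ z) < M₀ + 1 + 2 * (towerS (fun j => d * (M j - 1)) k : ℝ) := by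
  classical
  have hx' : ∃ x', chiBall N M₀ z x' ≠ 0 ∧ towerBlk (torusTower hM hdiv) k x' = towerBlk (torusTower hM hdiv) k x := by
    by_contra hne
    have : omegaBall hM hdiv k M₀ z x = 0 := by
      show blkHull (torusTower hM hdiv) k (chiBall N M₀ z) x = 0
      unfold blkHull
      rw [if_neg hne]
    rw [this] at hx
    exact zero_ne_one hx
  obtain ⟨x', hχ, hblk⟩ := hx'
  have hd' : dist x' (ctrU N M₀ z) < M₀ + 1 := by
    by_contra hfar
    apply hχ
    unfold chiBall
    rw [if_neg hfar]
  have hxx' : dist x x' ≤ 2 * (towerS (fun j => d * (M j - 1)) k : ℝ) := dist_le_of_towerBlk_eq hM hdiv k hblk.symm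
  calc dist x (ctrU N M₀ z) ≤ dist x x' + dist x' (ctrU N M₀ z) := dist_triangle _ _ _
    _ < 2 * (towerS (fun j => d * (M j - 1)) k : ℝ) + (M₀ + 1) := add_lt_add_of_le_of_lt hxx' hd'
    _ = M₀ + 1 + 2 * (towerS (fun j => d * (M j - 1)) k : ℝ) := by ring

/-- MODEL bookkeeping: **the multiplicity of the block-hull cover**, ν_k(M₀) = (2(M₀ + 1 + 2S_k)/M₀ + 3)^d. [folklore] -/
def coverNumber (d : ℕ) (M : ℕ → ℕ) (k M₀ : ℕ) : ℝ :=
  (2 * ((M₀ + 1 + 2 * (towerS (fun j => d * (M j - 1)) k : ℝ)) / M₀) + 3) ^ d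

/-- ν_k(M₀) ≥ 0. [folklore] -/
theorem coverNumber_nonneg (d : ℕ) (M : ℕ → ℕ) (k M₀ : ℕ) : 0 ≤ coverNumber d M k M₀ := by
  unfold coverNumber; positivity

/-- **EVERY POINT LIES IN AT MOST ν_k(M₀) OF THE REGIONS Ω₀(z)**: Σ_z Ω₀(z)(x) ≤ (2(M₀ + 1 + 2S_k)/M₀ + 3)^d for every x,
every torus (1 ≤ M₀) — the centres z with Ω₀(z)(x) = 1 are within M₀ + 1 + 2S_k = c̄M₀ of x, and b05's sparse count
`B5TorusCover.hnu_holds` bounds their number by (2c̄ + 3)^d. [folklore] -/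
theorem sum_omegaBall_le {M : ℕ → ℕ} (hM : ∀ j, 1 ≤ M j) (hdiv : ∀ j i, M j ∣ N i) (k : ℕ) {M₀ : ℕ}
    (hM₀ : 1 ≤ M₀) (x : UT N) : ∑ z : Ctr N M₀, omegaBall hM hdiv k M₀ z x ≤ coverNumber d M k M₀ := by
  classical
  set S := (towerS (fun j => d * (M j - 1)) k : ℝ) with hS
  set cbar : ℝ := (M₀ + 1 + 2 * S) / M₀ with hcbar
  have hM0 : (0 : ℝ) < M₀ := by exact_mod_cast hM₀
  have hS0 : 0 ≤ S := Nat.cast_nonneg _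
  have hc0 : 0 ≤ cbar := by rw [hcbar]; positivity
  have hcM : cbar * M₀ = M₀ + 1 + 2 * S := by rw [hcbar]; field_simp
  -- the sum of a {0,1}-valued family is the number of ones
  have hsum : ∑ z : Ctr N M₀, omegaBall hM hdiv k M₀ z x =
      ((univ.filter fun z : Ctr N M₀ => omegaBall hM hdiv k M₀ z x = 1).card : ℝ) := by
    rw [Finset.card_eq_sum_ones, Nat.cast_sum, Finset.sum_filter]
    refine Finset.sum_congr rfl fun z _ => ?_
    rcases omegaBall_zero_or_one hM hdiv k M₀ z x with h | h <;> simp [h]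
  have hsub : (univ.filter fun z : Ctr N M₀ => omegaBall hM hdiv k M₀ z x = 1) ⊆
      univ.filter fun z : Ctr N M₀ => dist x (ctrU N M₀ z) ≤ cbar * M₀ := by
    intro z hz
    rw [Finset.mem_filter] at hz ⊢
    refine ⟨mem_univ _, ?_⟩
    rw [hcM]
    exact (dist_lt_of_omegaBall_eq_one hM hdiv k M₀ z x hz.2).le
  calc ∑ z : Ctr N M₀, omegaBall hM hdiv k M₀ z x
      = ((univ.filter fun z : Ctr N M₀ => omegaBall hM hdiv k M₀ z x = 1).card : ℝ) := hsum
    _ ≤ ((univ.filter fun z : Ctr N M₀ => dist x (ctrU N M₀ z) ≤ cbar * M₀).card : ℝ) := by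
        exact_mod_cast Finset.card_le_card hsub
    _ ≤ (2 * cbar + 3) ^ d := hnu_holds N hM₀ hc0 x
    _ = coverNumber d M k M₀ := by rw [coverNumber, hcbar]

/-! ## §2  Thm 3.7-shape in ℓ² for the tower operator: no hypothesis beyond the data and «M₀ large» -/

/-- **THM 3.7-SHAPE IN ℓ² FOR THE k-FOLD COVARIANT TOWER OPERATOR OF THE pv21 MODEL — NO HYPOTHESIS BEYOND THE DATA AND THE
EXPLICIT LARGENESS OF THE PARTITION SCALE (MODEL of [B9] Thm 3.7 «for M sufficiently large»).**  Δ′ = Δ_U + Σ_{l≤k} a_lG_lᵀG_l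
on the torus `UT N` (cube-comb tower of sides M_j, 1 ≤ M_j, M_j ∣ N_i; uniform block weights ω_l, a_l ≥ 0, top level on:
a_k ≥ a_min > 0, |ω_k| ≥ w_min > 0; EVERY isometric bond transport; c_min ≤ |c| ≤ c_max), the b05 partition of unity h_z at
scale M₀ (1 ≤ M₀, M₀ ∣ N_i, 2M₀ ≤ N_i) with block-hull regions Ω₀(z), G′₀ = Σ_z h_zG′_zh_z, R′ = Σ_z K(h_z)G′_zh_z.  If
q := (C_rem/M₀)·√(ν_k(M₀)²) < 1 (C_rem = `remConstTower`, ν_k(M₀) = `coverNumber`), then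
Δ′⁻¹ = G′₀∘(1 − R′)⁻¹ and ‖Δ′⁻¹‖_{ℓ²} ≤ σ_k⁻¹·√(ν_k(M₀)²)·(1 − q)⁻¹ — the same constants for every torus and every
transport. [folklore] -/
theorem parametrix_l2_tower_torus_explicit {Cp : Type} [Fintype Cp] [DecidableEq Cp] {M : ℕ → ℕ}
    (hM : ∀ j, 1 ≤ M j) (hdiv : ∀ j i, M j ∣ N i) (c : UT N × Fin d → ℝ) {cmin cmax : ℝ} (hcmin : 0 < cmin)
    (hc : ∀ b, cmin ≤ |c b|) (hc' : ∀ b, |c b| ≤ cmax) (Rm : UT N × Fin d → Cp → Cp → ℝ)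
    (hRm : ∀ b i j, ∑ k, Rm b k i * Rm b k j = if i = j then (1 : ℝ) else 0) (k : ℕ) (ω : Fin (k + 1) → ℝ)
    {wmax : ℝ} (hw' : ∀ l, |ω l| ≤ wmax) {a : Fin (k + 1) → ℝ} (ha : ∀ l, 0 ≤ a l) {amin wmin : ℝ}
    (hamin : 0 < amin) (hwmin : 0 < wmin) (hak : amin ≤ a (Fin.last k)) (hωk : wmin ≤ |ω (Fin.last k)|)
    {M₀ : ℕ} (hM₀ : 1 ≤ M₀) (hdiv₀ : ∀ i, M₀ ∣ N i) (h2N : ∀ i, 2 * M₀ ≤ N i)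
    (hlarge : remConstTower d M amin wmin cmin cmax wmax k a / M₀ *
      Real.sqrt (coverNumber d M k M₀ * coverNumber d M k M₀) < 1) :
    Ring.inverse (towerOp (torusTower hM hdiv) Rm c k (fun l _ => ω l) a) =
        (∑ z : Ctr N M₀, mulOp (hSU N M₀ z ∘ Prod.fst) *
            dirInv (towerOp (torusTower hM hdiv) Rm c k (fun l _ => ω l) a) (omegaBall hM hdiv k M₀ z ∘ Prod.fst) *
            mulOp (hSU N M₀ z ∘ Prod.fst)) *
          Ring.inverse (1 - ∑ z : Ctr N M₀, towerK (torusTower hM hdiv) Rm c k (fun l _ => ω l) a (hSU N M₀ z) *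
            dirInv (towerOp (torusTower hM hdiv) Rm c k (fun l _ => ω l) a) (omegaBall hM hdiv k M₀ z ∘ Prod.fst) *
            mulOp (hSU N M₀ z ∘ Prod.fst)) ∧
      L2Bound (Ring.inverse (towerOp (torusTower hM hdiv) Rm c k (fun l _ => ω l) a))
        ((sigmaTowerTorus d M amin wmin cmin k)⁻¹ * Real.sqrt (coverNumber d M k M₀ * coverNumber d M k M₀) *
          (1 - remConstTower d M amin wmin cmin cmax wmax k a / M₀ *
            Real.sqrt (coverNumber d M k M₀ * coverNumber d M k M₀))⁻¹) :=
  parametrix_l2_tower_torus hM hdiv c hcmin hc hc' Rm hRm k ω hw' ha hamin hwmin hak hωk hM₀ hdiv₀ h2N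
    (coverNumber_nonneg d M k M₀) (fun x => sum_omegaBall_le hM hdiv k hM₀ x) hlarge

omit [∀ i, NeZero (N i)] [NeZero d] in
/-- **The largeness condition is met for all large M₀**: √(ν_k(M₀)²) = ν_k(M₀) ≤ (7 + 4S_k)^d for M₀ ≥ 1, so q < 1 as soon
as M₀ > C_rem·(7 + 4S_k)^d (both sides explicit in d, M, k, a, c, w). [folklore] -/
theorem coverNumber_le {M : ℕ → ℕ} (k : ℕ) {M₀ : ℕ} (hM₀ : 1 ≤ M₀) :
    coverNumber d M k M₀ ≤ (7 + 4 * (towerS (fun j => d * (M j - 1)) k : ℝ)) ^ d := by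
  unfold coverNumber
  have hM0 : (1 : ℝ) ≤ M₀ := by exact_mod_cast hM₀
  have hS0 : 0 ≤ (towerS (fun j => d * (M j - 1)) k : ℝ) := Nat.cast_nonneg _
  set S := (towerS (fun j => d * (M j - 1)) k : ℝ) with hS
  have h1 : (M₀ + 1 + 2 * S) / M₀ ≤ 2 + 2 * S := by
    rw [div_le_iff₀ (by linarith)]
    nlinarith [mul_nonneg (sub_nonneg.mpr hM0) (by positivity : (0 : ℝ) ≤ 1 + 2 * S)]
  have hle : 2 * ((M₀ + 1 + 2 * S) / M₀) + 3 ≤ 7 + 4 * S := by linarith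
  exact pow_le_pow_left₀ (by positivity) hle d

end Torus

end

end Summit.QuantumFields.BalabanUV.Beta.CovariantTowerCover
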